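import Summits.AtomisticToContinuum.FouriersLaw.Theorems.EmbeddedDrudeMourreGreenKuboContinuationRealVitali
import Mathlib.Analysis.Calculus.MeanValue
import Mathlib.Analysis.Calculus.IteratedDeriv.Lemmas

/-!
# Real-variable Vitali propagation, `k ≥ 2` form (`stub_realVitaliTwo`)

`--supports` file for crux `EmbeddedDrudeMourre.GreenKuboContinuation` (stmt-AtomisticToContinuum-12597), line
`temperature-blind-vitali-hurwitz`, skeleton rev 4. The landed `stub_realVitali`
(`Theorems/EmbeddedDrudeMourreGreenKuboContinuationRealVitali.lean`, p72547) propagates the convergence of a family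
`g ν : ℝ → ℝ` from a corner `(0, T₀)` to all `T > 0` under `ν`-uniform factorial bounds on ALL derivatives of order
`k ≥ 1` on compacts. The parallel deep-refute seat (refuter-drefute-stmt-AtomisticToContinuum-12597-g2-0, crux workfile
`Cruxes/GreenKuboContinuation/DrefuteK1RedundantRev3.lean`, sorry-free) observed that the `k = 1` bound is NOT needed:
given convergence at two seed points, the `k = 2` bound and the mean value theorem bound the first derivative uniformly
after a rescaling `ν ↦ δν`. This file lands that upgrade (lemmas adapted with attribution) as the registered stub
`stub_realVitaliTwo`, through which the rev-4 composition consumes the log-Gevrey tower directly — making the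
first-order modulus K1 (`stub_thermalExponent`, revs 1–3) redundant. Pure real analysis; everything proved.
-/

noncomputable section

namespace Summit.AtomisticToContinuum.FouriersLaw.Theorems.GreenKuboContinuation.TemperatureBlindVitaliHurwitz

open Filter Topology Set

/-- Rescaling the vanishing parameter: `ν ↦ c ν` maps `𝓝[>] 0` into itself for `c > 0`. [folklore] (adapted from `Cruxes/GreenKuboContinuation/DrefuteK1RedundantRev3.lean`, seat
refuter-drefute-stmt-AtomisticToContinuum-12597-g2-0) -/
theorem tendsto_const_mul_nhdsGT {c : ℝ} (hc : 0 < c) :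
    Tendsto (fun ν : ℝ => c * ν) (𝓝[>] (0:ℝ)) (𝓝[>] (0:ℝ)) := by
  refine tendsto_nhdsWithin_iff.2 ⟨?_, ?_⟩
  · have h : Tendsto (fun ν : ℝ => c * ν) (𝓝 (0:ℝ)) (𝓝 (c * 0)) :=
      tendsto_const_nhds.mul tendsto_id
    rw [mul_zero] at h
    exact h.mono_left nhdsWithin_le_nhds
  · filter_upwards [self_mem_nhdsWithin] with ν hν
    exact mul_pos hc hν

/-- MEAN-VALUE BOUND ON THE FIRST DERIVATIVE. If `f` is differentiable on `(0,∞)` with `deriv f`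
differentiable there and `|f''| ≤ M` on `[a', b'] ∋ T₁ < T₂`, then for every `x ∈ [a', b']`,
`|f'(x)| ≤ (|f T₂| + |f T₁|)/(T₂ - T₁) + M (b' - a')`. [folklore] (adapted from `Cruxes/GreenKuboContinuation/DrefuteK1RedundantRev3.lean`, seat
refuter-drefute-stmt-AtomisticToContinuum-12597-g2-0) -/
theorem abs_deriv_le_of_two_points {f : ℝ → ℝ} {a' b' T₁ T₂ M : ℝ}
    (ha' : 0 < a') (h1 : a' ≤ T₁) (h12 : T₁ < T₂) (h2 : T₂ ≤ b')
    (hd0 : DifferentiableOn ℝ f (Ioi 0)) (hd1 : DifferentiableOn ℝ (deriv f) (Ioi 0))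
    (hM : ∀ y ∈ Icc a' b', |deriv (deriv f) y| ≤ M) {x : ℝ} (hx : x ∈ Icc a' b') :
    |deriv f x| ≤ (|f T₂| + |f T₁|) / (T₂ - T₁) + M * (b' - a') := by
  have hsub : Icc a' b' ⊆ Ioi (0:ℝ) := fun y hy => ha'.trans_le hy.1
  -- mean value theorem on [T₁, T₂]
  have hcont : ContinuousOn f (Icc T₁ T₂) :=
    hd0.continuousOn.mono fun y hy => hsub ⟨h1.trans hy.1, hy.2.trans h2⟩
  have hdiff : DifferentiableOn ℝ f (Ioo T₁ T₂) :=
    hd0.mono fun y hy => hsub ⟨h1.trans hy.1.le, hy.2.le.trans h2⟩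
  obtain ⟨ξ, hξ, hξeq⟩ := exists_deriv_eq_slope f h12 hcont hdiff
  have hξI : ξ ∈ Icc a' b' := ⟨h1.trans hξ.1.le, hξ.2.le.trans h2⟩
  have hpos : 0 < T₂ - T₁ := sub_pos.2 h12
  have hslope : |deriv f ξ| ≤ (|f T₂| + |f T₁|) / (T₂ - T₁) := by
    rw [hξeq, abs_div, abs_of_pos hpos]
    exact div_le_div_of_nonneg_right (abs_sub _ _) hpos.le
  -- Lipschitz bound for deriv f on the convex set [a', b']
  have hlip : ‖deriv f x - deriv f ξ‖ ≤ M * ‖x - ξ‖ :=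
    (convex_Icc a' b').norm_image_sub_le_of_norm_deriv_le
      (fun y hy => (hd1 y (hsub hy)).differentiableAt (Ioi_mem_nhds (hsub hy)))
      (fun y hy => by rw [Real.norm_eq_abs]; exact hM y hy) hξI hx
  rw [Real.norm_eq_abs, Real.norm_eq_abs] at hlip
  have hMnn : 0 ≤ M := (abs_nonneg _).trans (hM ξ hξI)
  have hdist : |x - ξ| ≤ b' - a' := by
    rw [abs_le]; constructor <;> linarith [hx.1, hx.2, hξI.1, hξI.2]
  calc |deriv f x| = |(deriv f x - deriv f ξ) + deriv f ξ| := by ring_nf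
    _ ≤ |deriv f x - deriv f ξ| + |deriv f ξ| := abs_add_le _ _
    _ ≤ M * (b' - a') + (|f T₂| + |f T₁|) / (T₂ - T₁) :=
        add_le_add (hlip.trans (mul_le_mul_of_nonneg_left hdist hMnn)) hslope
    _ = _ := by ring

/-- **The `k ≥ 2` real-Vitali propagation** (`stub_realVitaliTwo` of the rev-4 skeleton of line
`temperature-blind-vitali-hurwitz`, crux `EmbeddedDrudeMourre.GreenKuboContinuation`, stmt-AtomisticToContinuum-12597):
the statement of the landed `stub_realVitali` (p72547) with the factorial bounds assumed for orders `k ≥ 2` ONLY.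
Proof (refuter-drefute-…-g2-0, `realVitali_two_of_one`, adapted): rescale `ν ↦ δν` so that the values at the two
seed points `T₀/3`, `2T₀/3` are bounded uniformly in `ν ∈ (0,1]`; the mean value theorem between the seed points plus
the `k = 2` bound then give a `ν`-uniform bound on the FIRST derivative on every compact (`abs_deriv_le_of_two_points`),
i.e. the `k ≥ 1` hypotheses of `stub_realVitali`; scale back. Consequence for the line: the first-order modulus K1
(`stub_thermalExponent` of revs 1–3) is REDUNDANT — the tower (`k ≥ 2`) and the corner seed suffice. [folklore] -/
theorem stub_realVitaliTwo :
    ∀ (g : ℝ → ℝ → ℝ) (T₀ : ℝ), 0 < T₀ →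
      (∀ ν : ℝ, 0 < ν → ν ≤ 1 → ∀ k : ℕ, DifferentiableOn ℝ (iteratedDeriv k (g ν)) (Set.Ioi 0)) →
      (∀ a b : ℝ, 0 < a → a < b → ∃ C : ℝ, 0 < C ∧ ∀ ν : ℝ, 0 < ν → ν ≤ 1 →
        ∀ k : ℕ, 2 ≤ k → ∀ T ∈ Set.Icc a b,
          |iteratedDeriv k (g ν) T| ≤ C ^ (k + 1) * (k.factorial : ℝ)) →
      (∀ T : ℝ, 0 < T → T < T₀ →
        ∃ L : ℝ, Filter.Tendsto (fun ν : ℝ => g ν T) (nhdsWithin (0:ℝ) (Set.Ioi 0)) (nhds L)) →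
      ∀ T : ℝ, 0 < T →
        ∃ L : ℝ, Filter.Tendsto (fun ν : ℝ => g ν T) (nhdsWithin (0:ℝ) (Set.Ioi 0)) (nhds L) := by
  intro g T₀ hT₀ hs hb hc T hT
  -- two seed points in the corner
  obtain ⟨L₁, hL₁⟩ := hc (T₀ / 3) (by positivity) (by linarith)
  obtain ⟨L₂, hL₂⟩ := hc (2 * T₀ / 3) (by positivity) (by linarith)
  have h12 : T₀ / 3 < 2 * T₀ / 3 := by linarith
  -- eventually the values at the seed points are bounded
  have hev : ∀ᶠ ν in 𝓝[>] (0:ℝ), |g ν (T₀ / 3)| ≤ |L₁| + 1 ∧ |g ν (2 * T₀ / 3)| ≤ |L₂| + 1 := by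
    have h1 := (Metric.tendsto_nhds.1 hL₁) 1 one_pos
    have h2 := (Metric.tendsto_nhds.1 hL₂) 1 one_pos
    filter_upwards [h1, h2] with ν h1 h2
    rw [Real.dist_eq] at h1 h2
    constructor
    · calc |g ν (T₀ / 3)| = |(g ν (T₀ / 3) - L₁) + L₁| := by ring_nf
        _ ≤ |g ν (T₀ / 3) - L₁| + |L₁| := abs_add_le _ _
        _ ≤ |L₁| + 1 := by linarith
    · calc |g ν (2 * T₀ / 3)| = |(g ν (2 * T₀ / 3) - L₂) + L₂| := by ring_nf
        _ ≤ |g ν (2 * T₀ / 3) - L₂| + |L₂| := abs_add_le _ _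
        _ ≤ |L₂| + 1 := by linarith
  obtain ⟨δ₀, hδ₀pos, hδ₀⟩ := mem_nhdsGT_iff_exists_Ioc_subset.1 hev
  have hδ₀pos' : 0 < δ₀ := hδ₀pos
  set δ : ℝ := min δ₀ 1 with hδdef
  have hδpos : 0 < δ := lt_min hδ₀pos' one_pos
  have hδν : ∀ ν : ℝ, 0 < ν → ν ≤ 1 → 0 < δ * ν ∧ δ * ν ≤ 1 ∧ δ * ν ≤ δ₀ := by
    intro ν hν hν1
    refine ⟨mul_pos hδpos hν, ?_, ?_⟩
    · calc δ * ν ≤ 1 * 1 := mul_le_mul (min_le_right _ _) hν1 hν.le zero_le_one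
        _ = 1 := one_mul 1
    · calc δ * ν ≤ δ₀ * 1 := mul_le_mul (min_le_left _ _) hν1 hν.le hδ₀pos'.le
        _ = δ₀ := mul_one δ₀
  have hbd : ∀ ν : ℝ, 0 < ν → ν ≤ 1 →
      |g (δ * ν) (T₀ / 3)| ≤ |L₁| + 1 ∧ |g (δ * ν) (2 * T₀ / 3)| ≤ |L₂| + 1 :=
    fun ν hν hν1 => hδ₀ ⟨(hδν ν hν hν1).1, (hδν ν hν hν1).2.2⟩
  -- the rescaled family  g' ν := g (δ ν)
  have hs' : ∀ ν : ℝ, 0 < ν → ν ≤ 1 → ∀ k : ℕ,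
      DifferentiableOn ℝ (iteratedDeriv k (g (δ * ν))) (Ioi 0) :=
    fun ν hν hν1 k => hs (δ * ν) (hδν ν hν hν1).1 (hδν ν hν hν1).2.1 k
  have hb' : ∀ a b : ℝ, 0 < a → a < b → ∃ C : ℝ, 0 < C ∧ ∀ ν : ℝ, 0 < ν → ν ≤ 1 →
      ∀ k : ℕ, 1 ≤ k → ∀ x ∈ Icc a b,
        |iteratedDeriv k (g (δ * ν)) x| ≤ C ^ (k + 1) * (k.factorial : ℝ) := by
    intro a b ha hab
    -- enlarge [a, b] so that it contains both seed points
    have ha' : 0 < min a (T₀ / 3) := lt_min ha (by positivity)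
    have hab' : min a (T₀ / 3) < max b (2 * T₀ / 3) :=
      (min_le_left _ _).trans_lt (hab.trans_le (le_max_left _ _))
    obtain ⟨C, hC, hCb⟩ := hb (min a (T₀ / 3)) (max b (2 * T₀ / 3)) ha' hab'
    set B : ℝ := (|L₂| + 1 + (|L₁| + 1)) / (2 * T₀ / 3 - T₀ / 3) +
      C ^ 3 * 2 * (max b (2 * T₀ / 3) - min a (T₀ / 3)) with hBdef
    set C' : ℝ := max (max C 1) B with hC'def
    have hC'1 : 1 ≤ C' := (le_max_right C 1).trans (le_max_left _ _)
    have hC'C : C ≤ C' := (le_max_left C 1).trans (le_max_left _ _)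
    refine ⟨C', lt_of_lt_of_le one_pos hC'1, ?_⟩
    intro ν hν hν1 k hk x hx
    have hx' : x ∈ Icc (min a (T₀ / 3)) (max b (2 * T₀ / 3)) :=
      ⟨(min_le_left _ _).trans hx.1, hx.2.trans (le_max_left _ _)⟩
    obtain ⟨hν', hν'1, -⟩ := hδν ν hν hν1
    rcases Nat.lt_or_ge k 2 with hk2 | hk2
    · obtain rfl : k = 1 := by omega
      rw [iteratedDeriv_one]
      -- the mean-value bound on the first derivative
      have hd0 : DifferentiableOn ℝ (g (δ * ν)) (Ioi 0) := by
        have := hs (δ * ν) hν' hν'1 0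
        rwa [iteratedDeriv_zero] at this
      have hd1 : DifferentiableOn ℝ (deriv (g (δ * ν))) (Ioi 0) := by
        have := hs (δ * ν) hν' hν'1 1
        rwa [iteratedDeriv_one] at this
      have hM : ∀ y ∈ Icc (min a (T₀ / 3)) (max b (2 * T₀ / 3)),
          |deriv (deriv (g (δ * ν))) y| ≤ C ^ 3 * 2 := by
        intro y hy
        have := hCb (δ * ν) hν' hν'1 2 le_rfl y hy
        rw [show iteratedDeriv 2 (g (δ * ν)) = deriv (deriv (g (δ * ν))) from by
          rw [iteratedDeriv_succ, iteratedDeriv_one]] at this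
        simpa [Nat.factorial] using this
      have key := abs_deriv_le_of_two_points ha' (min_le_right _ _) h12 (le_max_right _ _)
        hd0 hd1 hM hx'
      have hB : |deriv (g (δ * ν)) x| ≤ B := by
        refine key.trans ?_
        rw [hBdef]
        have := (hbd ν hν hν1).1
        have := (hbd ν hν hν1).2
        have hpos : 0 < 2 * T₀ / 3 - T₀ / 3 := by linarith
        gcongr
      calc |deriv (g (δ * ν)) x| ≤ B := hB
        _ ≤ C' := le_max_right _ _
        _ = C' * 1 := (mul_one _).symm
        _ ≤ C' * C' := mul_le_mul_of_nonneg_left hC'1 (zero_le_one.trans hC'1)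
        _ = C' ^ (1 + 1) * ((1:ℕ).factorial : ℝ) := by simp [pow_two]
    · calc |iteratedDeriv k (g (δ * ν)) x| ≤ C ^ (k + 1) * (k.factorial : ℝ) :=
            hCb (δ * ν) hν' hν'1 k hk2 x hx'
        _ ≤ C' ^ (k + 1) * (k.factorial : ℝ) :=
            mul_le_mul_of_nonneg_right (pow_le_pow_left₀ hC.le hC'C _) (Nat.cast_nonneg _)
  have hc' : ∀ T : ℝ, 0 < T → T < T₀ →
      ∃ L : ℝ, Tendsto (fun ν : ℝ => g (δ * ν) T) (𝓝[>] 0) (𝓝 L) := by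
    intro T' hT' hlt
    obtain ⟨L, hL⟩ := hc T' hT' hlt
    exact ⟨L, hL.comp (tendsto_const_mul_nhdsGT hδpos)⟩
  -- apply the k ≥ 1 statement to the rescaled family and scale back
  obtain ⟨L, hL⟩ := stub_realVitali (fun ν => g (δ * ν)) T₀ hT₀ hs' hb' hc' T hT
  refine ⟨L, ?_⟩
  have h := hL.comp (tendsto_const_mul_nhdsGT (inv_pos.2 hδpos))
  refine h.congr fun ν => ?_
  simp only [Function.comp_apply, mul_inv_cancel_left₀ hδpos.ne']


end Summit.AtomisticToContinuum.FouriersLaw.Theorems.GreenKuboContinuation.TemperatureBlindVitaliHurwitz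

end
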